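import Mathlib.Topology.Algebra.InfiniteSum.Constructions
import Mathlib.Analysis.Complex.Basic
import Mathlib.Data.Fintype.Option
import HarnessLib

/-!
# Countable linear independence of character families is stable under PRODUCTS on pure tensors
# (the fibre-regrouping step behind Rogawski's Prop. 13.8.1 for a semi-local group `G_∞ × ∏_{v ∈ S} G_v`)

Topic `NumberTheory/Automorphic`; namespace `Literature.NumberTheory.Automorphic`.  ONE light definition with body (`IsCountablyLinIndepOn`, the shape of
[Rogawski1990, Prop. 13.8.1]: «`Σ_{π ∈ X} a(π) Tr π(f) = 0` absolutely convergent for all test `f` ⇒ `X = ∅`», read for a family of «characters»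
`Θ : I → Φ → ℂ`, a support set `U ⊆ I` and a class of tests `P`) and THEOREMS, all proved; no named fact, no instance, no notation, no `sorry`.
Pure summability algebra over Mathlib (`Summable.prod_factor`, `Summable.prod`, `Summable.tsum_prod`, `Equiv.summable_iff`, `Fintype.induction_empty_option`);
no representation theory.  Cell `hodgecm-mathlib`, floor 0, programme P3: node N4 ∕ N4′ of the statement tree of the letter (L2-SA) #85
`Rogawski1990.SemilocalCharactersLinIndep` (`F0/P3/T1b-TREE.md`, seat typ-T1b); the last theorem `eq_zero_of_piFinset` is, token for token, the text of the stub
`stub_finiteProductStep` of the Lines draft `F0/P3/Lines-draft/T1b_SemilocalCharactersLinIndep.lean` (closes it BY NAME).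

THE MATHEMATICS (the «WHY PURE TENSORS SUFFICE» paragraph of ★ `Rogawski1990/SemilocalCharactersLinIndep`; [LabesseLanglands1979, Lemma 6.1] is the one-group
statement).  Let `Θ_i` (`i ∈ I`) and `Ξ_j` (`j ∈ J`) be two families of functionals on test classes `Φ`, `Ψ`, each COUNTABLY LINEARLY INDEPENDENT on support sets
`U`, `W`: every coefficient family supported there whose sums `Σ_i b_i Θ_i(φ)` are (absolutely) summable with sum `0` for all tests vanishes.  Then the product
family `(i, j) ↦ Θ_i(φ) Ξ_j(ψ)` is countably linearly independent on `U × W` against PURE TENSORS `(φ, ψ)`: for fixed `ψ` the fibre sums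
`b_ψ(i) := Σ'_j a(i,j) Ξ_j(ψ)` form a summable family with `Σ_i b_ψ(i) Θ_i(φ) = Σ_{(i,j)} a(i,j) Θ_i(φ) Ξ_j(ψ) = 0`, so `b_ψ = 0` for every `ψ`, and then
`a(i, ·) = 0` by the hypothesis on `Ξ` (the fibre `j ↦ a(i,j) Ξ_j(ψ)` is summable: for `i ∈ U` there is a test `φ` with `Θ_i(φ) ≠ 0` — apply the hypothesis to
`δ_i` — and `j ↦ a(i,j) Θ_i(φ) Ξ_j(ψ)` is a sub-family of a summable family).  Iterating over a finite index type (Mathlib `Fintype.induction_empty_option`: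
empty type, `Option` step via `Equiv.piOptionEquivProd` and `Fintype.prod_option`, invariance under reindexing via `Equiv.piCongrLeft` and `Fintype.prod_equiv`)
gives the base-times-finite-product version, and the `Finset`-subtype form the letter #85 uses (`I × ∀ v : ↥S, X v`, character `Θ(x.1) · ∏_{v : ↥S} Ξ_v(x.2 v)`).

* `IsCountablyLinIndepOn U P Θ` (definition) · `isCountablyLinIndepOn_iff` · `IsCountablyLinIndepOn.exists_ne_zero` (a supported index has a test with non-zero value) ·
  `IsCountablyLinIndepOn.transport` (reindexing along an equivalence with enough tests) · `IsCountablyLinIndepOn.prod` (TWO FACTORS) ·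
  `IsCountablyLinIndepOn.piFintype` (base × finite product) · `eq_zero_of_piFinset` (the `Finset` form = the stub text).

## References
* J. D. Rogawski, *Automorphic Representations of Unitary Groups in Three Variables*, Ann. of Math. Stud. 123 (1990), Prop. 13.8.1 p. 206 [Rogawski1990].
* J.-P. Labesse, R. P. Langlands, *L-indistinguishability for SL(2)*, Canad. J. Math. 31 (1979), Lemma 6.1 pp. 768–769 [LabesseLanglands1979].
-/

set_option autoImplicit false

noncomputable section

open scoped BigOperators

namespace Literature.NumberTheory.Automorphic

universe u u' v v' w

/-! ## §1 The notion -/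

/-- **Countable linear independence of a family of functionals on a support set against a class of tests**: `Θ : I → Φ → ℂ` is countably linearly
independent ON `U ⊆ I` AGAINST the tests `P` when every coefficient family `b : I → ℂ` supported in `U` such that `i ↦ b i · Θ i φ` is summable with sum `0`
for every test `φ` (`P φ`) vanishes identically — the shape of Rogawski's Prop. 13.8.1 («`Σ_{π∈X} a(π) Tr(π(f)) = 0` absolutely convergent for all `f` ⇒ `X`
empty»; in `ℂ` summable = absolutely summable). [cite: Rogawski1990, Prop. 13.8.1 p. 206] -/
def IsCountablyLinIndepOn {I : Type u} {Φ : Type v} (U : Set I) (P : Φ → Prop) (Θ : I → Φ → ℂ) : Prop :=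
  ∀ b : I → ℂ, (∀ i, b i ≠ 0 → i ∈ U) → (∀ φ, P φ → Summable fun i => b i * Θ i φ) →
    (∀ φ, P φ → ∑' i, b i * Θ i φ = 0) → ∀ i, b i = 0

/-- Unfolding of `IsCountablyLinIndepOn` (`Iff.rfl`). [cite: Rogawski1990, Prop. 13.8.1 p. 206] -/
theorem isCountablyLinIndepOn_iff {I : Type u} {Φ : Type v} (U : Set I) (P : Φ → Prop) (Θ : I → Φ → ℂ) :
    IsCountablyLinIndepOn U P Θ ↔
      ∀ b : I → ℂ, (∀ i, b i ≠ 0 → i ∈ U) → (∀ φ, P φ → Summable fun i => b i * Θ i φ) →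
        (∀ φ, P φ → ∑' i, b i * Θ i φ = 0) → ∀ i, b i = 0 :=
  Iff.rfl

namespace IsCountablyLinIndepOn

/-! ## §2 Two elementary consequences: non-degeneracy on the support set, reindexing -/

section Basic

variable {I : Type u} {Φ : Type v} {U : Set I} {P : Φ → Prop} {Θ : I → Φ → ℂ}

/-- **An index in the support set has a test with non-zero value** (apply the hypothesis to the coefficient family `δ_i`). [cite: Rogawski1990, Prop. 13.8.1 p. 206] -/
theorem exists_ne_zero (hΘ : IsCountablyLinIndepOn U P Θ) {i : I} (hi : i ∈ U) : ∃ φ, P φ ∧ Θ i φ ≠ 0 := by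
  classical
  by_contra h
  push Not at h
  have hsupp : ∀ i', Pi.single (M := fun _ : I => ℂ) i 1 i' ≠ 0 → i' ∈ U := fun i' hi' => by
    by_cases h' : i' = i
    · rw [h']; exact hi
    · exact absurd (by simp [h']) hi'
  have hzero : ∀ φ, P φ → ∀ i', Pi.single (M := fun _ : I => ℂ) i 1 i' * Θ i' φ = 0 := fun φ hφ i' => by
    by_cases h' : i' = i
    · rw [h', h φ hφ, mul_zero]
    · simp [h']
  have h1 := hΘ (Pi.single i 1) hsupp
    (fun φ hφ => (summable_zero (α := ℂ)).congr fun i' => (hzero φ hφ i').symm)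
    (fun φ hφ => by rw [tsum_congr (hzero φ hφ), tsum_zero]) i
  simp at h1

/-- **Reindexing**: countable linear independence passes to a family `Θ'` on `I'` along an equivalence `e : I' ≃ I` mapping the new support set into the old
one, provided every old test is matched by a new test with the same values (`Θ' i' φ' = Θ (e i') φ`). [cite: Rogawski1990, Prop. 13.8.1 p. 206] -/
theorem transport {I' : Type u'} {Φ' : Type v'} (hΘ : IsCountablyLinIndepOn U P Θ) (e : I' ≃ I) {U' : Set I'} (hU : ∀ i', i' ∈ U' → e i' ∈ U)
    {P' : Φ' → Prop} {Θ' : I' → Φ' → ℂ} (hΦ : ∀ φ, P φ → ∃ φ', P' φ' ∧ ∀ i', Θ' i' φ' = Θ (e i') φ) :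
    IsCountablyLinIndepOn U' P' Θ' := by
  intro a' ha' hs' h0' i'
  have key := hΘ (fun i => a' (e.symm i)) (fun i hi => by
      have := hU (e.symm i) (ha' _ hi)
      rwa [e.apply_symm_apply] at this)
    (fun φ hφ => by
      obtain ⟨φ', hφ', hval⟩ := hΦ φ hφ
      have h1 := hs' φ' hφ'
      rw [← e.summable_iff]
      refine h1.congr fun j => ?_
      simp only [Function.comp_apply, e.symm_apply_apply, hval])
    (fun φ hφ => by
      obtain ⟨φ', hφ', hval⟩ := hΦ φ hφ
      have h1 := h0' φ' hφ'
      rw [← e.tsum_eq]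
      simp only [e.symm_apply_apply, ← hval]
      exact h1)
    (e i')
  simpa only [e.symm_apply_apply] using key

end Basic

/-! ## §3 Two factors: the fibre-regrouping step -/

section TwoFactors

variable {I : Type u} {J : Type u'} {Φ : Type v} {Ψ : Type v'}
  {U : Set I} {W : Set J} {P : Φ → Prop} {Q : Ψ → Prop} {Θ : I → Φ → ℂ} {Ξ : J → Ψ → ℂ}

/-- **PRODUCTS ON PURE TENSORS** (the fibre-regrouping step of [LabesseLanglands1979, Lemma 6.1] ∕ [Rogawski1990, Prop. 13.8.1] for a product of two
groups): if `Θ` is countably linearly independent on `U` against `P` and `Ξ` on `W` against `Q`, then `(i, j) ↦ Θ i φ · Ξ j ψ` is countably linearly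
independent on `U ×ˢ W` against the pure tensors `(φ, ψ)` with `P φ ∧ Q ψ`.  Proof: for fixed `ψ` the fibre sums `b_ψ(i) := Σ'_j a(i,j) Ξ j ψ` are killed by
the hypothesis on `Θ` (Mathlib `Summable.prod`, `Summable.tsum_prod`), then `a(i, ·)` by the hypothesis on `Ξ` (fibre summability through `exists_ne_zero` and
`Summable.prod_factor`). [cite: Rogawski1990, Prop. 13.8.1 p. 206] [cite: LabesseLanglands1979, Lemma 6.1 pp. 768–769] -/
theorem prod (hΘ : IsCountablyLinIndepOn U P Θ) (hΞ : IsCountablyLinIndepOn W Q Ξ) :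
    IsCountablyLinIndepOn (U ×ˢ W) (fun p : Φ × Ψ => P p.1 ∧ Q p.2) (fun x p => Θ x.1 p.1 * Ξ x.2 p.2) := by
  intro a ha hs h0
  -- Step 1: every fibre `j ↦ a (i, j) * Ξ j ψ` is summable
  have hfib : ∀ i ψ, Q ψ → Summable fun j => a (i, j) * Ξ j ψ := by
    intro i ψ hψ
    by_cases hi : ∃ j, a (i, j) ≠ 0
    · obtain ⟨j₀, hj₀⟩ := hi
      have hiU : i ∈ U := (Set.mem_prod.1 (ha (i, j₀) hj₀)).1
      obtain ⟨φ, hφ, hne⟩ := hΘ.exists_ne_zero hiU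
      have h1 : Summable fun j => a (i, j) * (Θ i φ * Ξ j ψ) := (hs (φ, ψ) ⟨hφ, hψ⟩).prod_factor i
      refine (h1.mul_left (Θ i φ)⁻¹).congr fun j => ?_
      field_simp
    · push Not at hi
      exact (summable_zero (α := ℂ)).congr fun j => by rw [hi j, zero_mul]
  -- Step 2: the fibre sums vanish for every test `ψ`
  have hb : ∀ ψ, Q ψ → ∀ i, ∑' j, a (i, j) * Ξ j ψ = 0 := by
    intro ψ hψ
    refine hΘ (fun i => ∑' j, a (i, j) * Ξ j ψ) ?_ ?_ ?_
    · intro i hi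
      by_contra hiU
      apply hi
      have hz : ∀ j, a (i, j) = 0 := fun j => by
        by_contra hij
        exact hiU (Set.mem_prod.1 (ha (i, j) hij)).1
      simp only [hz, zero_mul, tsum_zero]
    · intro φ hφ
      refine ((hs (φ, ψ) ⟨hφ, hψ⟩).prod).congr fun i => ?_
      show ∑' j, a (i, j) * (Θ i φ * Ξ j ψ) = (∑' j, a (i, j) * Ξ j ψ) * Θ i φ
      rw [← tsum_mul_right]
      exact tsum_congr fun j => by ring
    · intro φ hφ
      have h := (hs (φ, ψ) ⟨hφ, hψ⟩).tsum_prod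
      have h0' := h0 (φ, ψ) ⟨hφ, hψ⟩
      rw [h] at h0'
      rw [← h0']
      refine tsum_congr fun i => ?_
      show (∑' j, a (i, j) * Ξ j ψ) * Θ i φ = ∑' j, a (i, j) * (Θ i φ * Ξ j ψ)
      rw [← tsum_mul_right]
      exact tsum_congr fun j => by ring
  -- Step 3: each row `a (i, ·)` vanishes
  rintro ⟨i, j⟩
  exact hΞ (fun j => a (i, j)) (fun j hj => (Set.mem_prod.1 (ha (i, j) hj)).2) (fun ψ hψ => hfib i ψ hψ) (fun ψ hψ => hb ψ hψ i) j

end TwoFactors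

/-! ## §4 A base family times a FINITE PRODUCT of families (induction over the finite index type) -/

section Pi

variable {I : Type u} {Φ : Type v} {U : Set I} {P : Φ → Prop} {Θ : I → Φ → ℂ}

/-- The induction behind `piFintype`, phrased as a property of the finite index type `σ` (Mathlib `Fintype.induction_empty_option`: invariance under
reindexing via `Equiv.piCongrLeft` ∕ `Fintype.prod_equiv`; the empty type via `Equiv.prodUnique`; the `Option` step = `prod` + `Equiv.piOptionEquivProd` +
`Fintype.prod_option`). [cite: Rogawski1990, Prop. 13.8.1 p. 206] -/
private theorem piFintype_aux (hΘ : IsCountablyLinIndepOn U P Θ) (σ : Type w) [Fintype σ] :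
    ∀ {X : σ → Type u'} {T : σ → Type v'} (W : ∀ s, Set (X s)) (Q : ∀ s, T s → Prop) (Ξ : ∀ s, X s → T s → ℂ),
      (∀ s, IsCountablyLinIndepOn (W s) (Q s) (Ξ s)) →
      IsCountablyLinIndepOn {x : I × (∀ s, X s) | x.1 ∈ U ∧ ∀ s, x.2 s ∈ W s}
        (fun p : Φ × (∀ s, T s) => P p.1 ∧ ∀ s, Q s (p.2 s))
        (fun x p => Θ x.1 p.1 * ∏ s, Ξ s (x.2 s) (p.2 s)) := by
  refine Fintype.induction_empty_option
    (P := fun (σ : Type w) [Fintype σ] =>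
      ∀ {X : σ → Type u'} {T : σ → Type v'} (W : ∀ s, Set (X s)) (Q : ∀ s, T s → Prop) (Ξ : ∀ s, X s → T s → ℂ),
        (∀ s, IsCountablyLinIndepOn (W s) (Q s) (Ξ s)) →
        IsCountablyLinIndepOn {x : I × (∀ s, X s) | x.1 ∈ U ∧ ∀ s, x.2 s ∈ W s}
          (fun p : Φ × (∀ s, T s) => P p.1 ∧ ∀ s, Q s (p.2 s))
          (fun x p => Θ x.1 p.1 * ∏ s, Ξ s (x.2 s) (p.2 s)))
    ?_ ?_ ?_ σ
  · -- invariance under reindexing `e : α ≃ β`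
    intro α β _ e hα X T W Q Ξ hΞ
    letI : Fintype α := Fintype.ofEquiv β e.symm
    have h := @hα (fun a => X (e a)) (fun a => T (e a)) (fun a => W (e a)) (fun a => Q (e a)) (fun a => Ξ (e a))
      (fun a => hΞ (e a))
    refine h.transport ((Equiv.refl I).prodCongr (Equiv.piCongrLeft X e).symm) ?_ ?_
    · rintro ⟨i, f⟩ ⟨hi, hf⟩
      refine ⟨hi, fun a => ?_⟩
      simp only [Equiv.prodCongr_apply, Prod.map, Equiv.coe_refl, id, Equiv.piCongrLeft_symm_apply]
      exact hf (e a)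
    · rintro ⟨φ, t⟩ ⟨hφ, ht⟩
      refine ⟨(φ, Equiv.piCongrLeft T e t), ⟨hφ, fun b => ?_⟩, ?_⟩
      · obtain ⟨a, rfl⟩ := e.surjective b
        show Q (e a) (Equiv.piCongrLeft T e t (e a))
        rw [Equiv.piCongrLeft_apply_apply]
        exact ht a
      · rintro ⟨i, f⟩
        simp only [Equiv.prodCongr_apply, Prod.map, Equiv.coe_refl, id, Equiv.piCongrLeft_symm_apply]
        congr 1
        exact (Fintype.prod_equiv e (fun a => Ξ (e a) (f (e a)) (t a)) (fun b => Ξ b (f b) (Equiv.piCongrLeft T e t b))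
          (fun a => by rw [Equiv.piCongrLeft_apply_apply])).symm
  · -- the empty index type: the product is `1`
    intro X T W Q Ξ _
    haveI : Unique (∀ s : PEmpty, X s) := Pi.uniqueOfIsEmpty X
    refine hΘ.transport (Equiv.prodUnique I (∀ s : PEmpty, X s)) ?_ ?_
    · rintro ⟨i, f⟩ ⟨hi, -⟩
      exact hi
    · intro φ hφ
      refine ⟨(φ, fun s => isEmptyElim s), ⟨hφ, fun s => isEmptyElim s⟩, ?_⟩
      rintro ⟨i, f⟩
      simp [Finset.univ_eq_empty]
  · -- the `Option` step: one more factor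
    intro α _ ih X T W Q Ξ hΞ
    have h1 := @ih (fun a => X (some a)) (fun a => T (some a)) (fun a => W (some a)) (fun a => Q (some a)) (fun a => Ξ (some a))
      (fun a => hΞ (some a))
    have h2 := (hΞ none).prod h1
    -- `I × (∀ o, X o) ≃ X none × (I × ∀ a, X (some a))`
    let eπ : (∀ o : Option α, X o) ≃ X none × (∀ a, X (some a)) := Equiv.piOptionEquivProd
    let eidx : (I × (∀ o : Option α, X o)) ≃ X none × (I × (∀ a, X (some a))) :=
      ((Equiv.refl I).prodCongr eπ).trans
        (((Equiv.prodAssoc I (X none) (∀ a, X (some a))).symm.trans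
          ((Equiv.prodComm I (X none)).prodCongr (Equiv.refl _))).trans
          (Equiv.prodAssoc (X none) I (∀ a, X (some a))))
    have heidx : ∀ (i : I) (f : ∀ o : Option α, X o), eidx (i, f) = (f none, (i, fun a => f (some a))) := fun i f => rfl
    refine h2.transport eidx ?_ ?_
    · rintro ⟨i, f⟩ ⟨hi, hf⟩
      rw [heidx]
      exact Set.mk_mem_prod (hf none) ⟨hi, fun a => hf (some a)⟩
    · rintro ⟨t₀, ⟨φ, t⟩⟩ ⟨ht₀, hφ, ht⟩
      refine ⟨(φ, (Equiv.piOptionEquivProd (β := T)).symm (t₀, t)), ⟨hφ, fun o => ?_⟩, ?_⟩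
      · cases o with
        | none => exact ht₀
        | some a => exact ht a
      · rintro ⟨i, f⟩
        rw [heidx, Fintype.prod_option]
        show Θ i φ * (Ξ none (f none) t₀ * ∏ a, Ξ (some a) (f (some a)) (t a)) =
          Ξ none (f none) t₀ * (Θ i φ * ∏ a, Ξ (some a) (f (some a)) (t a))
        ring

/-- **A BASE FAMILY TIMES A FINITE PRODUCT OF FAMILIES** (the semi-local shape `G_∞ × ∏_{v ∈ S} G_v`): if `Θ` is countably linearly independent on `U` against
`P` and, for every `s` in a finite index type `σ`, `Ξ s` is so on `W s` against `Q s`, then `x ↦ Θ x.1 φ · ∏_s Ξ s (x.2 s) (t s)` on `I × ∀ s, X s` is countably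
linearly independent on `{x | x.1 ∈ U ∧ ∀ s, x.2 s ∈ W s}` against the pure tensors `(φ, t)` with `P φ ∧ ∀ s, Q s (t s)`.
[cite: Rogawski1990, Prop. 13.8.1 p. 206] [cite: LabesseLanglands1979, Lemma 6.1 pp. 768–769] -/
theorem piFintype (hΘ : IsCountablyLinIndepOn U P Θ) {σ : Type w} [Fintype σ]
    {X : σ → Type u'} {T : σ → Type v'} (W : ∀ s, Set (X s)) (Q : ∀ s, T s → Prop) (Ξ : ∀ s, X s → T s → ℂ)
    (hΞ : ∀ s, IsCountablyLinIndepOn (W s) (Q s) (Ξ s)) :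
    IsCountablyLinIndepOn {x : I × (∀ s, X s) | x.1 ∈ U ∧ ∀ s, x.2 s ∈ W s}
      (fun p : Φ × (∀ s, T s) => P p.1 ∧ ∀ s, Q s (p.2 s))
      (fun x p => Θ x.1 p.1 * ∏ s, Ξ s (x.2 s) (p.2 s)) :=
  piFintype_aux hΘ σ W Q Ξ hΞ

end Pi

end IsCountablyLinIndepOn

/-! ## §5 The `Finset` form (token for token the stub `stub_finiteProductStep` of the #85 Lines draft) -/

/-- **FINITE PRODUCT STEP, `Finset` form** — for a finite set `S` of places, a base family `Θ` on `I` countably linearly independent on `U` against `P₀` and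
families `Ξ a` on `X a` countably linearly independent on `W a` against `P a` for `a ∈ S`, every coefficient family on `I × ∀ s : ↥S, X s` supported in
`U × ∏ W`, whose product-character sums over pure tensors `(φ, t)` are summable with sum `0`, vanishes.  (`IsCountablyLinIndepOn.piFintype` at `σ := ↥S`,
hypotheses and conclusion spelled out.) [cite: Rogawski1990, Prop. 13.8.1 p. 206] [cite: LabesseLanglands1979, Lemma 6.1 pp. 768–769] -/
theorem eq_zero_of_piFinset {α : Type w} (S : Finset α)
    {I : Type u} {Φ₀ : Type v} (U : Set I) (P₀ : Φ₀ → Prop) (Θ : I → Φ₀ → ℂ)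
    {X : α → Type u'} {T : α → Type v'} (W : ∀ a, Set (X a)) (P : ∀ a, T a → Prop) (Ξ : ∀ a, X a → T a → ℂ)
    (hΘ : ∀ b : I → ℂ, (∀ i, b i ≠ 0 → i ∈ U) → (∀ φ, P₀ φ → Summable fun i => b i * Θ i φ) →
      (∀ φ, P₀ φ → ∑' i, b i * Θ i φ = 0) → ∀ i, b i = 0)
    (hΞ : ∀ a ∈ S, ∀ b : X a → ℂ, (∀ x, b x ≠ 0 → x ∈ W a) → (∀ t, P a t → Summable fun x => b x * Ξ a x t) →
      (∀ t, P a t → ∑' x, b x * Ξ a x t = 0) → ∀ x, b x = 0)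
    (a : I × (∀ s : ↥S, X s) → ℂ)
    (ha : ∀ x, a x ≠ 0 → x.1 ∈ U ∧ ∀ s : ↥S, x.2 s ∈ W s)
    (hs : ∀ (φ : Φ₀) (t : ∀ s : ↥S, T s), P₀ φ → (∀ s : ↥S, P s (t s)) →
      Summable fun x => a x * (Θ x.1 φ * ∏ s : ↥S, Ξ s (x.2 s) (t s)))
    (h0 : ∀ (φ : Φ₀) (t : ∀ s : ↥S, T s), P₀ φ → (∀ s : ↥S, P s (t s)) →
      ∑' x, a x * (Θ x.1 φ * ∏ s : ↥S, Ξ s (x.2 s) (t s)) = 0)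
    (x : I × (∀ s : ↥S, X s)) : a x = 0 :=
  IsCountablyLinIndepOn.piFintype (U := U) (P := P₀) (Θ := Θ) hΘ (σ := ↥S)
    (fun s => W s) (fun s => P s) (fun s => Ξ s) (fun s => hΞ s s.2) a ha
    (fun p hp => hs p.1 p.2 hp.1 hp.2) (fun p hp => h0 p.1 p.2 hp.1 hp.2) x

end Literature.NumberTheory.Automorphic

end
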